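import Mathlib.Algebra.Polynomial.Bivariate
import Mathlib.Algebra.Polynomial.Expand
import Mathlib.Algebra.Polynomial.Derivative
import Mathlib.Algebra.CharP.Lemmas
import Mathlib.FieldTheory.Perfect
import Mathlib.FieldTheory.Finite.Basic
import HarnessLib

/-!
# Shears `(X, Y) ↦ (X + cY, Y)` of the affine plane and bivariate polynomials

Elementary algebra of the coordinate changes `Φ(X, Y) ↦ Φ(X + cY, Y)` of `K[X][Y]` used to put an
arbitrary plane curve in the normal form required by the function-field point counts of
`PlaneCurvePointCountProofs` (monic in `Y` of degree equal to the total degree, with separable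
irreducible factors): the shear as a `K`-algebra automorphism (`aevalAeval (C X + C (C c) * Y) Y`),
its effect on evaluation and on the number of rational zeros, its commutation with base change,
the chain rule `∂_Y Φ(X + cY, Y) = (c ∂_X Φ + ∂_Y Φ)(X + cY, Y)`, and the `p`-th power lemma over a
perfect field of characteristic `p`: a bivariate polynomial with `∂_X Φ = ∂_Y Φ = 0` is a `p`-th
power, hence not irreducible (so that every irreducible factor becomes separable in `Y` after all
but at most one shear).

No definitions: the shear is the displayed `aevalAeval` term and `∂_X` is written
`swap ∘ derivative ∘ swap` with Mathlib's `Polynomial.Bivariate.swap`.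

## References

Folklore; used in the proof of Cafure–Matera 2006, Thm. 5.2 (through Lemma 5.1 = Schmidt 1974,
Lemma 5) to normalise plane sections. [CafureMatera2006]
-/

noncomputable section

open scoped Classical Polynomial.Bivariate
open Polynomial

namespace Literature.NumberTheory.DiophantineGeometry.PlaneShear

universe u v

/-- The shear `Φ(X, Y) ↦ Φ(X + cY, Y)` of `K[X][Y]` (local notation for the `aevalAeval` term). -/
local notation3 "sh[" K ", " c "]" =>
  (Polynomial.aevalAeval (R := K) (A := Polynomial (Polynomial K))
    (Polynomial.C Polynomial.X + Polynomial.C (Polynomial.C c) * Polynomial.X) Polynomial.X)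

/-! ### Extensionality for maps out of `K[X][Y]` -/

section Ext

variable {K : Type u} [CommRing K]

/-- Two `K`-algebra maps out of `K[X][Y]` agreeing on `X` and `Y` are equal. [folklore] -/
theorem algHom_ext_CX_Y {A : Type v} [CommSemiring A] [Algebra K A] {f g : K[X][Y] →ₐ[K] A}
    (hX : f (C X) = g (C X)) (hY : f Y = g Y) : f = g :=
  (aevalAevalEquiv K A).symm.injective (Prod.ext hX hY)

/-- Two ring maps out of `K[X][Y]` agreeing on constants, `X` and `Y` are equal. [folklore] -/
theorem ringHom_ext_CC_CX_Y {S : Type v} [Semiring S] {f g : K[X][Y] →+* S}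
    (hC : ∀ k : K, f (C (C k)) = g (C (C k))) (hX : f (C X) = g (C X)) (hY : f Y = g Y) :
    f = g := by
  refine Polynomial.ringHom_ext (fun a ↦ ?_) hY
  have h : f.comp C = g.comp C := Polynomial.ringHom_ext (fun k ↦ hC k) hX
  exact congrArg (fun φ : K[X] →+* S ↦ φ a) h

end Ext

/-! ### The shear `Φ(X, Y) ↦ Φ(X + cY, Y)` -/

section Shear

variable {K : Type u} [CommRing K]

/-- The shear on the generator `X`. [folklore] -/
theorem shear_CX (c : K) : sh[K, c] (C X) = C X + C (C c) * Y :=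
  aevalAeval_X _ _

/-- The shear on the generator `Y`. [folklore] -/
theorem shear_Y (c : K) : sh[K, c] Y = Y :=
  aevalAeval_Y _ _

/-- The shear on constants. [folklore] -/
theorem shear_CC (c k : K) : sh[K, c] (C (C k)) = C (C k) := by
  rw [aevalAeval_C, aeval_C]; rfl

/-- The shear on a coefficient `a(X) ∈ K[X]`: `a(X + cY)`. [folklore] -/
theorem shear_C (c : K) (a : K[X]) : sh[K, c] (C a) = aeval (C X + C (C c) * Y : K[X][Y]) a :=
  aevalAeval_C _ _ _

/-- Shears compose additively: `Φ((X + c'Y) + cY, Y)`. [folklore] -/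
theorem shear_comp (c c' : K) : (sh[K, c]).comp (sh[K, c']) = sh[K, c' + c] := by
  refine algHom_ext_CX_Y ?_ ?_
  · rw [AlgHom.comp_apply, shear_CX, shear_CX, map_add, map_mul, shear_CX, shear_CC, shear_Y,
      map_add, map_add]
    ring
  · rw [AlgHom.comp_apply, shear_Y, shear_Y, shear_Y]

/-- The trivial shear is the identity. [folklore] -/
theorem shear_zero : sh[K, (0 : K)] = AlgHom.id K _ := by
  refine algHom_ext_CX_Y ?_ ?_
  · rw [shear_CX, map_zero, map_zero, zero_mul, add_zero, AlgHom.id_apply]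
  · rw [shear_Y, AlgHom.id_apply]

/-- The shears by `c` and `-c` are inverse to each other. [folklore] -/
theorem shear_comp_neg (c : K) : (sh[K, c]).comp (sh[K, -c]) = AlgHom.id K _ := by
  rw [shear_comp, neg_add_cancel, shear_zero]

/-- The shears by `-c` and `c` are inverse to each other. [folklore] -/
theorem shear_neg_comp (c : K) : (sh[K, -c]).comp (sh[K, c]) = AlgHom.id K _ := by
  rw [shear_comp, add_neg_cancel, shear_zero]

/-- Undoing a shear. [folklore] -/
theorem shear_neg_shear (c : K) (P : K[X][Y]) : sh[K, -c] (sh[K, c] P) = P := by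
  rw [← AlgHom.comp_apply, shear_neg_comp, AlgHom.id_apply]

/-- The shear is injective. [folklore] -/
theorem shear_injective (c : K) : Function.Injective (sh[K, c]) := by
  intro P Q h
  have := congrArg (sh[K, -c]) h
  rwa [shear_neg_shear, shear_neg_shear] at this

/-- **Evaluation of a sheared polynomial:** `Φ(X + cY, Y)(a, b) = Φ(a + cb, b)`. [folklore] -/
theorem evalEval_shear (c : K) (P : K[X][Y]) (a b : K) :
    (sh[K, c] P).evalEval a b = P.evalEval (a + c * b) b := by
  have h : (aevalAeval a b : K[X][Y] →ₐ[K] K).comp (sh[K, c]) = aevalAeval (a + c * b) b := by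
    refine algHom_ext_CX_Y ?_ ?_
    · rw [AlgHom.comp_apply, shear_CX, map_add, map_mul, aevalAeval_X, aevalAeval_Y, aevalAeval_X,
        aevalAeval_C, aeval_C, Algebra.algebraMap_self_apply]
    · rw [AlgHom.comp_apply, shear_Y, aevalAeval_Y, aevalAeval_Y]
  have := congrArg (fun φ : K[X][Y] →ₐ[K] K ↦ φ P) h
  simp only [AlgHom.comp_apply] at this
  rw [← coe_aevalAeval_eq_evalEval, ← coe_aevalAeval_eq_evalEval]
  exact this

/-- **A shear does not change the number of rational zeros** (`(a, b) ↦ (a + cb, b)` is a bijection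
of `K²`). [folklore] -/
theorem card_filter_evalEval_shear [Fintype K] (c : K) (P : K[X][Y]) :
    (Finset.univ.filter fun p : K × K ↦ (sh[K, c] P).evalEval p.1 p.2 = 0).card =
      (Finset.univ.filter fun p : K × K ↦ P.evalEval p.1 p.2 = 0).card := by
  refine Finset.card_bij (fun p _ ↦ (p.1 + c * p.2, p.2)) (fun p hp ↦ ?_) (fun p₁ h₁ p₂ h₂ h ↦ ?_)
    (fun p hp ↦ ?_)
  · rw [Finset.mem_filter] at hp ⊢
    exact ⟨Finset.mem_univ _, by rw [← evalEval_shear]; exact hp.2⟩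
  · simp only [Prod.mk.injEq] at h
    obtain ⟨h1, h2⟩ := h
    ext
    · rw [h2] at h1; exact add_right_cancel h1
    · exact h2
  · refine ⟨(p.1 - c * p.2, p.2), ?_, ?_⟩
    · rw [Finset.mem_filter] at hp ⊢
      refine ⟨Finset.mem_univ _, ?_⟩
      rw [evalEval_shear, sub_add_cancel]
      exact hp.2
    · simp

/-- **Shears commute with base change:** `σ(Φ(X + cY, Y)) = (σΦ)(X + σ(c) Y, Y)`. [folklore] -/
theorem map_shear {L : Type v} [CommRing L] (σ : K →+* L) (c : K) (P : K[X][Y]) :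
    (sh[K, c] P).map (mapRingHom σ) = sh[L, σ c] (P.map (mapRingHom σ)) := by
  have h : (mapRingHom (mapRingHom σ)).comp (sh[K, c]).toRingHom =
      (sh[L, σ c]).toRingHom.comp (mapRingHom (mapRingHom σ)) := by
    refine ringHom_ext_CC_CX_Y (fun k ↦ ?_) ?_ ?_
    · simp only [RingHom.comp_apply, AlgHom.toRingHom_eq_coe, RingHom.coe_coe, shear_CC,
        coe_mapRingHom, map_C]
    · simp only [RingHom.comp_apply, AlgHom.toRingHom_eq_coe, RingHom.coe_coe, shear_CX,
        coe_mapRingHom, Polynomial.map_add, Polynomial.map_mul, map_C, map_X]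
    · simp only [RingHom.comp_apply, AlgHom.toRingHom_eq_coe, RingHom.coe_coe, shear_Y,
        coe_mapRingHom, map_X]
  have := congrArg (fun φ : K[X][Y] →+* L[X][Y] ↦ φ P) h
  simpa using this

/-- **A shear preserves absolute irreducibility** (base change to a field `L`, then the shear by
`σ(c)` is an automorphism of `L[X][Y]`). [folklore] -/
theorem irreducible_map_shear_iff {L : Type v} [Field L] (σ : K →+* L) (c : K) (P : K[X][Y]) :
    Irreducible ((sh[K, c] P).map (mapRingHom σ)) ↔ Irreducible (P.map (mapRingHom σ)) := by
  rw [map_shear]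
  set e : L[X][Y] ≃ₐ[L] L[X][Y] := AlgEquiv.ofAlgHom (sh[L, σ c]) (sh[L, -σ c])
    (shear_comp_neg (σ c)) (shear_neg_comp (σ c)) with he
  exact MulEquiv.irreducible_iff e.toMulEquiv (x := P.map (mapRingHom σ))

/-- A shear preserves irreducibility. [folklore] -/
theorem irreducible_shear_iff {F : Type u} [Field F] (c : F) (P : F[X][Y]) :
    Irreducible (sh[F, c] P) ↔ Irreducible P := by
  set e : F[X][Y] ≃ₐ[F] F[X][Y] := AlgEquiv.ofAlgHom (sh[F, c]) (sh[F, -c])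
    (shear_comp_neg c) (shear_neg_comp c) with he
  exact MulEquiv.irreducible_iff e.toMulEquiv (x := P)

end Shear

/-! ### The chain rule for shears -/

section ChainRule

variable {K : Type u} [CommRing K]

/-- **Chain rule for the shear:** `∂_Y (Φ(X + cY, Y)) = (c ∂_X Φ + ∂_Y Φ)(X + cY, Y)`, with
`∂_X Φ` written `swap (∂ (swap Φ))`. [folklore] -/
theorem derivative_shear (c : K) (P : K[X][Y]) :
    derivative (sh[K, c] P) =
      sh[K, c] (C (C c) * Bivariate.swap (derivative (Bivariate.swap P)) + derivative P) := by
  induction P using Polynomial.induction_on' with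
  | add p q hp hq =>
    simp only [map_add, hp, hq, mul_add]
    ring
  | monomial n b =>
    induction b using Polynomial.induction_on' with
    | add p q hp hq =>
      simp only [map_add, mul_add] at hp hq ⊢
      rw [hp, hq]
      ring
    | monomial m a =>
      have hmon : (monomial n (monomial m a) : K[X][Y]) = C (C a) * C X ^ m * Y ^ n := by
        rw [← C_mul_X_pow_eq_monomial, ← C_mul_X_pow_eq_monomial, map_mul, map_pow]
      rw [hmon]
      simp only [map_mul, map_pow, map_add, map_natCast, Bivariate.swap_C_C, Bivariate.swap_X,
        Bivariate.swap_Y, shear_CC, shear_CX, shear_Y, derivative_mul, derivative_pow,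
        derivative_C, derivative_X, zero_mul, mul_zero, zero_add, add_zero, mul_one]
      rcases m with _ | m
      · simp
      · rcases n with _ | n
        · simp; ring
        · simp [pow_succ]; ring

end ChainRule

/-! ### The `p`-th power lemma -/

section PthPower

variable {K : Type u} [Field K]

/-- Coefficients of the swapped polynomial. [folklore] -/
theorem coeff_coeff_swap (u : K[X][Y]) (i j : ℕ) :
    ((Bivariate.swap u).coeff i).coeff j = (u.coeff j).coeff i := by
  induction u using Polynomial.induction_on' with
  | add p q hp hq => simp only [map_add, coeff_add, hp, hq]
  | monomial n b =>
    induction b using Polynomial.induction_on' with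
    | add p q hp hq => simp only [map_add, coeff_add, hp, hq]
    | monomial m a =>
      rw [Bivariate.swap_monomial_monomial]
      simp only [coeff_monomial]
      split_ifs <;> simp_all [coeff_monomial]

/-- **The `p`-th power lemma.** Over a perfect field of characteristic `p`, a bivariate polynomial
`u ∈ K[X][Y]` with `∂_Y u = 0` and `∂_X u = 0` is a `p`-th power: `u = Σ a_{jk} X^j Y^k` with
`a_{jk} = 0` unless `p ∣ j` and `p ∣ k`, and `a_{jk} = b_{jk}^p`, so `u = (Σ b_{jk} X^{j/p} Y^{k/p})^p`.
[folklore] -/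
theorem exists_pow_eq_of_derivative_eq_zero (p : ℕ) [Fact p.Prime] [CharP K p] [PerfectRing K p]
    {u : K[X][Y]} (hY : derivative u = 0) (hX : derivative (Bivariate.swap u) = 0) :
    ∃ w : K[X][Y], w ^ p = u := by
  have hp : p ≠ 0 := (Fact.out : p.Prime).ne_zero
  -- the `X`-derivative of every coefficient vanishes
  have hcoef : ∀ k, derivative (u.coeff k) = 0 := by
    intro k
    ext j
    rw [coeff_derivative, coeff_zero]
    have h := congrArg (fun P : K[X][Y] ↦ (P.coeff j).coeff k) hX
    simp only [coeff_derivative, coeff_zero] at h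
    rw [show ((j : K[X]) + 1 : K[X]) = C ((j : K) + 1) by simp, coeff_mul_C, coeff_coeff_swap] at h
    exact h
  -- contract in `Y`
  set u₁ : K[X][Y] := contract p u with hu₁def
  have hu₁ : expand K[X] p u₁ = u := expand_contract' p hY
  have hc₁ : ∀ k, derivative (u₁.coeff k) = 0 := fun k ↦ by
    rw [hu₁def, coeff_contract hp]; exact hcoef _
  -- `p`-th roots of the coefficients
  set g : K[X] → K[X] := fun a ↦ (contract p a).map ((frobeniusEquiv K p).symm : K →+* K) with hg
  have hgpow : ∀ a : K[X], derivative a = 0 → g a ^ p = a := by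
    intro a ha
    rw [← map_frobenius_expand, map_expand, hg, Polynomial.map_map]
    have hcomp : (frobenius K p).comp ((frobeniusEquiv K p).symm : K →+* K) = RingHom.id K := by
      ext x
      simp
    rw [hcomp, Polynomial.map_id]
    exact expand_contract' p ha
  refine ⟨∑ k ∈ u₁.support, monomial k (g (u₁.coeff k)), ?_⟩
  rw [sum_pow_char p, ← hu₁, expand_eq_sum, Polynomial.sum]
  refine Finset.sum_congr rfl fun k _ ↦ ?_
  rw [monomial_pow, hgpow _ (hc₁ k), ← C_mul_X_pow_eq_monomial, ← pow_mul, mul_comm k p]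

/-- **An irreducible bivariate polynomial over a perfect field of characteristic `p` has `∂_X ≠ 0`
or `∂_Y ≠ 0`** (otherwise it is a `p`-th power). [folklore] -/
theorem derivative_ne_zero_or_of_irreducible (p : ℕ) [Fact p.Prime] [CharP K p] [PerfectRing K p]
    {u : K[X][Y]} (hu : Irreducible u) :
    derivative (Bivariate.swap u) ≠ 0 ∨ derivative u ≠ 0 := by
  by_contra h
  push Not at h
  obtain ⟨w, hw⟩ := exists_pow_eq_of_derivative_eq_zero p h.2 h.1
  have hp2 : 2 ≤ p := (Fact.out : p.Prime).two_le
  have hfac : u = w * w ^ (p - 1) := by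
    rw [← pow_succ', Nat.sub_add_cancel (by omega), hw]
  have hwu : IsUnit w := by
    rcases hu.isUnit_or_isUnit hfac with h1 | h1
    · exact h1
    · exact (isUnit_pow_iff (by omega)).1 h1
  exact hu.not_isUnit (by rw [← hw]; exact hwu.pow p)

end PthPower

end Literature.NumberTheory.DiophantineGeometry.PlaneShear
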